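import Summits.CriticalPhenomena.PercolationContinuityZ3.Theorems.PercNearOneGluingNoHeavyLowerTailSahiE3LroOverDnf
import Summits.CriticalPhenomena.PercolationContinuityZ3.Theorems.PercNearOneGluingNoHeavyLowerTailSahiE3DnfTwoKahn
import Mathlib.Tactic.FinCases
import HarnessLib
import HarnessLib.Audit

/-!
# `NoHeavyLowerTail` (crux stmt-CriticalPhenomena-4575), Sahi programme P4: SAHI'S `C₃` / KAHN'S CONJECTURE 5 FOR EVERY LINEAR READ-ONCE
# FIRST SLOT OVER AN OR OF TWO DISJOINT CONJUNCTIONS — lattice, Boolean and `prodBernoulli` forms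

Support file (cell `prim-l12`, seat P4, generation 12; `--supports stmt-CriticalPhenomena-4575`).  No named facts, no sorries;
standard axioms; def-free.

Slot: `x₀ ∘₀ (x₁ ∘₁ (⋯ ∘ₙ₋₁ ((y₁∧…∧y_a) ∨ (z₁∧…∧z_b))))` (`∘ᵢ = ∨` iff `ops i`), coordinates indexed by `Fin n ⊕ (Fin (a+1) ⊕ Fin (b+1))`.
`latticeE3_nonneg_of_lro_over_dnf_two` (finite distributive lattice, LSM `μ ≥ 0`, join-primes, product pattern marginal with strictly
positive base factors), `latticeE3_nonneg_lro_over_dnf_two_prod` (`2^κ`, `θ > 0`), `kahn_of_lro_over_dnf_two` (`prodBernoulli p`,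
`0 < p < 1` on the pattern coordinates).  Examples: `w ∧ ((x₁∧x₂) ∨ (y₁∧y₂))`, `v ∨ (w ∧ ((x₁∧x₂∧x₃) ∨ y))`.  From
`…SahiE3LroOverDnf.cert_lro_over_dnf_two` and the kernel theorem, as in `…SahiE3DnfTwoSlot` / `…SahiE3DnfTwoKahn`.
-/

namespace Summit.CriticalPhenomena.PercolationContinuityZ3.Theorems.SahiE3LroOverDnfSlot

open Finset MeasureTheory Literature.Combinatorics.Sahi2008 Literature.Probability.Percolation
open Literature.Probability.LatticeModels (prodBernoulli sahiE3 mass latticeE3)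
open scoped BigOperators

section Lattice

variable {α : Type*} [DistribLattice α] [Fintype α] [DecidableEq α] [DecidableLE α]

open scoped Classical in
/-- **Sahi's `C₃` for a linear read-once slot over `(y₁∧…∧y_a) ∨ (z₁∧…∧z_b)`, lattice form.**  `L` finite distributive, `μ ≥ 0`
log-supermodular, `j : Fin n ⊕ (Fin (a+1) ⊕ Fin (b+1)) → L` join-primes, `A, B` up-sets, the slot `U` the preimage of the formula's
true patterns; if the pattern marginal is a product weight `∏ᵢ wᵢ(tᵢ)` with `w ≥ 0` and `w > 0` on the base coordinates, then
`0 ≤ latticeE3 μ U A B`. [this work] -/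
theorem latticeE3_nonneg_of_lro_over_dnf_two {μ : α → ℝ} (hμ₀ : 0 ≤ μ)
    (hμ : ∀ x y, μ x * μ y ≤ μ (x ⊓ y) * μ (x ⊔ y)) (n a b : ℕ) (ops : Fin n → Bool)
    {j : Fin n ⊕ (Fin (a + 1) ⊕ Fin (b + 1)) → α} (hj : ∀ i, SupPrime (j i))
    {F : (Fin n ⊕ (Fin (a + 1) ⊕ Fin (b + 1)) → Bool) → Finset α}
    (hF : ∀ (t : Fin n ⊕ (Fin (a + 1) ⊕ Fin (b + 1)) → Bool) (x : α), x ∈ F t ↔ ∀ i, (j i ≤ x ↔ t i = true))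
    {A B : Finset α} (hA : IsUpperSet (A : Set α)) (hB : IsUpperSet (B : Set α))
    (w : Fin n ⊕ (Fin (a + 1) ⊕ Fin (b + 1)) → Bool → ℝ) (hw : ∀ i c, 0 ≤ w i c) (hw' : ∀ i c, 0 < w (Sum.inr i) c)
    (hν : ∀ t, mass μ (F t) = ∏ i, w i (t i))
    (U' : Finset (Fin n ⊕ (Fin (a + 1) ⊕ Fin (b + 1)) → Bool))
    (hU' : ∀ t, t ∈ U' ↔ Fin.foldr n (fun i c => bif ops i then (t (Sum.inl i) || c) else (t (Sum.inl i) && c))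
      (decide ((∀ k, t (Sum.inr (Sum.inl k)) = true) ∨ (∀ k, t (Sum.inr (Sum.inr k)) = true))) = true) :
    0 ≤ latticeE3 μ (univ.filter fun x => (fun i => decide (j i ≤ x)) ∈ U') A B := by
  obtain ⟨-, R, Fl, h1, h2, h3, h4, h5, h6⟩ :=
    SahiE3LroOverDnf.cert_lro_over_dnf_two n a b ops w hw hw' (fun t => ∏ i, w i (t i)) (fun _ => rfl) U' hU'
  refine SahiE3PatternCertificate.latticeE3_nonneg_of_patternCertificate hμ₀ hμ hj hF hA hB U'
    (fun t => ∏ i, w i (t i)) (fun t => (hν t).symm) R Fl h1 h2 h3 h4 (fun s hs => (h5 s hs).ge) ?_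
  intro S S' hS hS'
  have hz : ∑ s ∈ (S ∩ S') ∩ U'ᶜ, (∑ t ∈ U', Fl t s - (∑ r : Fin n ⊕ (Fin (a + 1) ⊕ Fin (b + 1)) → Bool, ∏ i, w i (r i)) *
      (∑ r ∈ U', ∏ i, w i (r i)) * ∏ i, w i (s i)) = 0 :=
    Finset.sum_eq_zero fun s hs => by rw [h5 s (Finset.mem_inter.1 hs).2, sub_self]
  rw [hz, add_zero]
  exact h6 S S' hS hS'

end Lattice

section Cube

variable {κ : Type*} [Fintype κ] [DecidableEq κ]

/-- **Kahn's Conjecture 5 for a linear read-once first slot over `(y₁∧…∧y_a) ∨ (z₁∧…∧z_b)`, product weights on `2^κ`.**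
`μ(ω) = ∏_{u∈ω} θ_u` with `θ > 0`, distinct generators `v : Fin n ⊕ (Fin (a+1) ⊕ Fin (b+1)) → κ`, `A, B` arbitrary up-sets,
`U' ` the true patterns of the formula: `0 ≤ latticeE3 μ {ω | (v i ∈ ω)ᵢ ∈ U'} A B`. [this work] -/
theorem latticeE3_nonneg_lro_over_dnf_two_prod {θ : κ → ℝ} (hθ : ∀ u, 0 < θ u) (n a b : ℕ) (ops : Fin n → Bool)
    {v : Fin n ⊕ (Fin (a + 1) ⊕ Fin (b + 1)) → κ} (hv : Function.Injective v) {A B : Finset (Finset κ)}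
    (hA : IsUpperSet (A : Set (Finset κ))) (hB : IsUpperSet (B : Set (Finset κ)))
    (U' : Finset (Fin n ⊕ (Fin (a + 1) ⊕ Fin (b + 1)) → Bool))
    (hU' : ∀ t, t ∈ U' ↔ Fin.foldr n (fun i c => bif ops i then (t (Sum.inl i) || c) else (t (Sum.inl i) && c))
      (decide ((∀ k, t (Sum.inr (Sum.inl k)) = true) ∨ (∀ k, t (Sum.inr (Sum.inr k)) = true))) = true) :
    0 ≤ latticeE3 (fun ω : Finset κ => ∏ u ∈ ω, θ u)
      (univ.filter fun ω : Finset κ => (fun i => decide (v i ∈ ω)) ∈ U') A B := by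
  classical
  have hθ0 : ∀ u, 0 ≤ θ u := fun u => (hθ u).le
  set F : (Fin n ⊕ (Fin (a + 1) ⊕ Fin (b + 1)) → Bool) → Finset (Finset κ) :=
    fun t => univ.filter fun ω : Finset κ => ∀ l, (v l ∈ ω ↔ t l = true) with hFdef
  have hF : ∀ (t : Fin n ⊕ (Fin (a + 1) ⊕ Fin (b + 1)) → Bool) (ω : Finset κ), ω ∈ F t ↔ ∀ l, (v l ∈ ω ↔ t l = true) := by
    intro t ω; simp [hFdef]
  have hF' : ∀ (t : Fin n ⊕ (Fin (a + 1) ⊕ Fin (b + 1)) → Bool) (ω : Finset κ),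
      ω ∈ F t ↔ ∀ l, (({v l} : Finset κ) ≤ ω ↔ t l = true) := by
    intro t ω; rw [hF]; simp
  set C : ℝ := ∑ ω ∈ ((univ : Finset (Fin n ⊕ (Fin (a + 1) ⊕ Fin (b + 1)))).image v)ᶜ.powerset, ∏ u ∈ ω, θ u with hC
  have hCpos : 0 < C := by
    have h1 : (1 : ℝ) ≤ C := by
      have hmem : (∅ : Finset κ) ∈ ((univ : Finset (Fin n ⊕ (Fin (a + 1) ⊕ Fin (b + 1)))).image v)ᶜ.powerset := by simp
      have := Finset.single_le_sum (f := fun ω : Finset κ => ∏ u ∈ ω, θ u)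
        (fun ω _ => Finset.prod_nonneg fun u _ => hθ0 u) hmem
      simpa using this
    linarith
  set w : Fin n ⊕ (Fin (a + 1) ⊕ Fin (b + 1)) → Bool → ℝ :=
    fun i c => (if c = true then θ (v i) else 1) * (if i = Sum.inr (Sum.inl 0) then C else 1) with hw
  have hwpos : ∀ i c, 0 < w i c := by
    intro i c; simp only [hw]
    have := hθ (v i)
    split_ifs <;> positivity
  have hν : ∀ t, mass (fun ω : Finset κ => ∏ u ∈ ω, θ u) (F t) = ∏ i, w i (t i) := by
    intro t
    rw [SahiE3LroCube.mass_fib_prod θ hv hF t, ← hC, hw, Finset.prod_mul_distrib,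
      Finset.prod_ite_eq' univ (Sum.inr (Sum.inl 0) : Fin n ⊕ (Fin (a + 1) ⊕ Fin (b + 1)))]
    simp
  have key := latticeE3_nonneg_of_lro_over_dnf_two (SahiE3HitSlotProduct.prod_nonneg' hθ0) (SahiE3HitSlotProduct.prod_lsm θ)
    n a b ops (fun i => SahiE3CovHit.supPrime_singleton' (v i)) hF' hA hB w (fun i c => (hwpos i c).le)
    (fun i c => hwpos _ c) hν U' hU'
  have hslot : (univ.filter fun ω : Finset κ => (fun i => decide (({v i} : Finset κ) ≤ ω)) ∈ U') =
      univ.filter fun ω : Finset κ => (fun i => decide (v i ∈ ω)) ∈ U' := by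
    congr 1; ext ω; simp
  rw [hslot] at key
  exact key

end Cube

section Kahn

variable {ι : Type*} [Fintype ι]

open scoped Classical in
/-- **Kahn's Conjecture 5 for every linear read-once first slot over `(y₁∧…∧y_a) ∨ (z₁∧…∧z_b)`.**  `ι` finite,
`p : ι → [0,1]`, `v : Fin n ⊕ (Fin (a+1) ⊕ Fin (b+1)) → ι` injective with `0 < p (v i) < 1`, `ops : Fin n → Bool`, `U'` the true
patterns; then for ALL increasing `A, B ⊆ Set ι`:  `0 ≤ sahiE3 (prodBernoulli p) {ω | (v i ∈ ω)ᵢ ∈ U'} A B`. [this work] -/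
theorem kahn_of_lro_over_dnf_two (p : ι → unitInterval) (n a b : ℕ) (ops : Fin n → Bool)
    {v : Fin n ⊕ (Fin (a + 1) ⊕ Fin (b + 1)) → ι} (hv : Function.Injective v)
    (hp : ∀ i, 0 < (p (v i) : ℝ) ∧ (p (v i) : ℝ) < 1) {A B : Set (Set ι)} (hA : IsUpperSet A) (hB : IsUpperSet B)
    (U' : Finset (Fin n ⊕ (Fin (a + 1) ⊕ Fin (b + 1)) → Bool))
    (hU' : ∀ t, t ∈ U' ↔ Fin.foldr n (fun i c => bif ops i then (t (Sum.inl i) || c) else (t (Sum.inl i) && c))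
      (decide ((∀ k, t (Sum.inr (Sum.inl k)) = true) ∨ (∀ k, t (Sum.inr (Sum.inr k)) = true))) = true) :
    0 ≤ sahiE3 (prodBernoulli p) {ω : Set ι | (fun i => decide (v i ∈ ω)) ∈ U'} A B := by
  rw [← sahiE_three_ind]
  have hμ := isFKGMeasure_bernoulliWeight p
  have hA' : IsUpperSet ((A.toFinset : Finset (Set ι)) : Set (Set ι)) := by simpa using hA
  have hB' : IsUpperSet ((B.toFinset : Finset (Set ι)) : Set (Set ι)) := by simpa using hB
  have hF : ∀ (t : Fin n ⊕ (Fin (a + 1) ⊕ Fin (b + 1)) → Bool) (x : Set ι),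
      x ∈ (univ.filter fun x : Set ι => ∀ i, (({v i} : Set ι) ≤ x ↔ t i = true)) ↔
        ∀ i, (({v i} : Set ι) ≤ x ↔ t i = true) := fun t x => by simp
  have hw : ∀ (i : Fin n ⊕ (Fin (a + 1) ⊕ Fin (b + 1))) (c : Bool),
      0 < (if c = true then (p (v i) : ℝ) else 1 - (p (v i) : ℝ)) := by
    intro i c
    split_ifs
    · exact (hp i).1
    · exact sub_pos.2 (hp i).2
  have key := latticeE3_nonneg_of_lro_over_dnf_two hμ.nonneg hμ.mul_le_mul n a b ops
    (fun i => SahiE3MajSlot.supPrime_set_singleton (v i)) hF hA' hB'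
    (fun i c => if c = true then (p (v i) : ℝ) else 1 - (p (v i) : ℝ)) (fun i c => (hw i c).le) (fun i c => hw _ c)
    (fun t => SahiE3DnfTwoKahn.mass_bernoulliWeight_fibre' p hv _ t (hF t)) U' hU'
  rw [← sahiE_three_indicator_eq_latticeE3 hμ.sum_eq_one] at key
  refine le_of_le_of_eq key ?_
  congr 1
  funext i
  fin_cases i
  · funext ω
    simp [setInd_apply, DecisionTree.ind, Set.singleton_subset_iff]
  · funext ω
    simp [setInd_apply, DecisionTree.ind]
  · funext ω
    simp [setInd_apply, DecisionTree.ind]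

end Kahn

end Summit.CriticalPhenomena.PercolationContinuityZ3.Theorems.SahiE3LroOverDnfSlot
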